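import Literature.MathematicalPhysics.StatisticalMechanics.TriangularLatticeMaximalHexagon
import HarnessLib

/-!
# Davoli–Piovano–Stefanelli 2017, Theorem 1.4 PROVED: sharpness of the `N^{3/4}` law —
# explicit maximal-deviation minimizers on the triangular lattice

Topic `Literature/MathematicalPhysics/StatisticalMechanics`; sequel to
`TriangularLatticeEdgeIsoperimetry.lean` (Davoli–Piovano–Stefanelli 2017 typed; Theorem 1.4 stated there
as the named fact `DavoliPiovanoStefanelli2017_sharpness`) and `TriangularLatticeMaximalHexagon.lean`
(Proposition 3.7, Corollary 1.3 and the `N^{3/4}` law `n − #H_{r(M_n)} ≤ K_t n^{3/4} + 6√n + 5` proved).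
Cell `crystal3d-full`, literature-typing layer D-0088 (4), seat `littype-FC1-1` (gen 10).  This file
DISCHARGES `DavoliPiovanoStefanelli2017_sharpness`:
`theorem DavoliPiovanoStefanelli2017_sharpness_holds`.

## Source, as printed

[DavoliPiovanoStefanelli2017] E. Davoli, P. Piovano, U. Stefanelli, *Sharp `N^{3/4}` law for the
minimizers of the edge-isoperimetric problem on the triangular lattice*, J. Nonlinear Sci. **27**
(2017) 627–660.  Theorem 1.4 (p. 634): "A sequence of minimizers `M_{n_i}` satisfying (15)–(17) with
equalities can be explicitly constructed for `n_i := 2 + 3i + 3i²` with `i ∈ ℕ`."  §4.2, Step 1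
(p. 656–657): "we show that there exists a sequence of minimizers `M_n` such that, denoting by
`H_{r_{M_n}}` their maximal hexagons, `|M_n ∖ H_{r_{M_n}}| = K_n n^{3/4} + o(n^{3/4})` (85).  We will
explicitly construct the minimizers `M_n`" — a lattice hexagon `H_{r_n}` completed by parallelograms to a
configuration `C_c` from which "it is possible to remove up to `2r_n − 1` points … without changing
the perimeter of the configuration … It follows from (86) that `P(M_n) = p_n`"; Substep 1.2 and Step 2
(p. 657–658): "`H_{r_n}` is by construction the maximal hexagon of `M_n`" and "for those `n_j ∈ ℕ` of
the form `n_j = 2 + 3j + 3j²` there holds `K_{n_j} → 2/3^{1/4} =: K_t` (93) as `j → +∞`".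

## The construction formalised (label coordinates, `triPoint (x,y) = x t₁ + y t₂`)

For `a, k, m ∈ ℕ` let `D(a,k,m) := {(x,y) : 0 ≤ x ≤ 2a+3k, 0 ≤ y ≤ 2a+1, (y ≤ 2a ∧ a ≤ x+y ≤ 3a+3k)
∨ (y = 2a+1 ∧ x ≤ m)}` — the hexagon `H_a + (a,a)` swept by `3k` steps along `t₁` plus `m+1` labels of
the next row (`devConfig`).  It is 3-convex (`m ≤ a+3k`), has `2a+2` rows, `2a+3k+1` columns and
`2a+3k+1` diagonals, i.e. `L = 6(a+k) + 4` lines (`m+1 ≤ a+3k`), and `#D = 3a²+3a+1 + 3k(2a+1) + m+1`.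
With `k(i) := ⌊√⌊i/3⌋⌋` (`3k² ≤ i < 3(k+1)²`) put `S_i := D(i−k, k, 3k²)` and
`M_{n_i} := triPoint(S_i)` (`sharpConfig`): `#S_i = 3i²+3i+2 = n_i`, `L(S_i) = 6i+4 = ⌈√(12n_i−3)⌉`
(`12n_i − 3 = (6i+3)² + 12`), so `b = 3n_i − L = [3n_i − √(12n_i−3)]` — `M_{n_i}` attains Harborth's
bound, i.e. is an EIP minimizer (`isTriMinimizer_of_lineCount_eq`, the converse direction of
`lineCount_eq_ceil`); `S_0 = {(0,0),(0,1)}`.  Since `S_i` has only `2(i−k)+2` rows, its maximal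
hexagon has radius `≤ i − k`, whence `n_i − #H_{r(M_{n_i})} ≥ n_i − #H_{i−k} = 6ik − 3k² + 3k + 1 ≥
2√3·i√i − 7i`.  Together with the upper bound `≤ K_t n_i^{3/4} + 6√n_i + 5`
(`card_sub_card_maxHexagon_le`) and `n_i^{3/4} = √n_i·√√n_i`, the ratio
`(n_i − #H_{r(M_{n_i})})/n_i^{3/4}` is squeezed between `(2√3 − 7/√i)/(√q_i √√q_i)`, `q_i = n_i/i² → 3`,
and `K_t + 6/√√n_i + 5/(√n_i √√n_i)`, both tending to `2√3/(√3·√√3) = 2/√√3 = K_t`.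

## Contents (namespace `Literature.MathematicalPhysics.StatisticalMechanics.DavoliPiovanoStefanelli2017`)

§1 `devConfig`, `mem_devConfig`, `isTriConvex_devConfig`, `image_snd/fst/sum_devConfig`,
`lineCount_devConfig`, `card_devConfig`, `maxHexRadius_devConfig_le`.  §2 `isTriMinimizer_of_lineCount_eq`,
`ceil_sqrt_eq`.  §3 `kOf`, `kOf_spec`, `kOf_le`, `kOf_cond`, `sharpLabels`, `sharpConfig`,
`card_sharpLabels`, `card_sharpConfig`, `lineCount_sharpLabels_zero`, `isTriMinimizer_sharpConfig`,
`maxHexRadius_sharpConfig_le`, `deviation_sharpConfig_ge`.  §4 `rpow_three_quarters_eq`,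
`sharpConstant_eq`, `six_mul_kOf_ge`, `ratio_sharpConfig_le`, `le_ratio_sharpConfig`,
`tendsto_ratio_sharpConfig`, `DavoliPiovanoStefanelli2017_sharpness_holds`.
-/

noncomputable section

open Set Filter Function Metric Finset
open scoped Topology

namespace Literature.MathematicalPhysics.StatisticalMechanics.DavoliPiovanoStefanelli2017

open Theil2006 (Plane triPoint triangularLattice triPoint_injective)
open Literature.Geometry.DiscreteGeometry (harborthNumber adjCount_le_two_mul_harborthNumber)
open Literature.Geometry.DiscreteGeometry.Harborth (harborthNumber_eq_sub_ceil)
open Literature.Geometry.DiscreteGeometry.HarborthSpiral (hexagon mem_hexagon Inside Adj adjCount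
  rot6 rot6inv IsRowConvex bondCount adjCount_eq_two_mul_bondCount
  erodeN lineCount IsTriConvex mem_erodeN card_image_rot6 mem_image_rot6 bondCount_add_lineCount
  hexagon_mono image_snd_image_rot6 image_snd_image_rot6_rot6)

/-! ## §1 The configurations `D(a,k,m)` -/

/-- **The label set `D(a,k,m)`**: the lattice hexagon `H_a + (a,a)` swept by `3k` unit steps along
`t₁` (rows `0 ≤ y ≤ 2a`, where `0 ≤ x ≤ 2a + 3k` and `a ≤ x + y ≤ 3a + 3k`), together with the first
`m + 1` labels `(0, 2a+1), …, (m, 2a+1)` of the next row.  [cite: DavoliPiovanoStefanelli2017, §4.2 Step 1 p. 656–657] -/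
def devConfig (a k m : ℕ) : Finset (ℤ × ℤ) :=
  ((Finset.Icc (0 : ℤ) (2 * a + 3 * k)) ×ˢ (Finset.Icc (0 : ℤ) (2 * a + 1))).filter fun p =>
    (p.2 ≤ 2 * a ∧ (a : ℤ) ≤ p.1 + p.2 ∧ p.1 + p.2 ≤ 3 * a + 3 * k) ∨ (p.2 = 2 * a + 1 ∧ p.1 ≤ m)

/-- Membership in `D(a,k,m)`. [cite: DavoliPiovanoStefanelli2017, §4.2 Step 1 p. 656–657] -/
theorem mem_devConfig {a k m : ℕ} {p : ℤ × ℤ} :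
    p ∈ devConfig a k m ↔ (0 ≤ p.1 ∧ p.1 ≤ 2 * a + 3 * k) ∧ (0 ≤ p.2 ∧ p.2 ≤ 2 * a + 1) ∧
      ((p.2 ≤ 2 * a ∧ (a : ℤ) ≤ p.1 + p.2 ∧ p.1 + p.2 ≤ 3 * a + 3 * k) ∨
        (p.2 = 2 * a + 1 ∧ p.1 ≤ m)) := by
  simp only [devConfig, Finset.mem_filter, Finset.mem_product, Finset.mem_Icc, and_assoc]

/-- **`D(a,k,m)` is 3-convex** (row-convex in the three lattice directions) when `m ≤ a + 3k`.
[cite: DavoliPiovanoStefanelli2017, §4.2 Step 1 p. 656–657] -/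
theorem isTriConvex_devConfig {a k m : ℕ} (hm : m ≤ a + 3 * k) : IsTriConvex (devConfig a k m) := by
  refine ⟨?_, ?_, ?_⟩
  · intro t u w v hu hv huw hwv
    rw [mem_devConfig] at hu hv ⊢
    dsimp only at hu hv ⊢
    omega
  · intro t u w v hu hv huw hwv
    rw [mem_image_rot6, mem_devConfig] at hu hv ⊢
    simp only [rot6inv] at hu hv ⊢
    omega
  · intro t u w v hu hv huw hwv
    rw [mem_image_rot6, mem_image_rot6, mem_devConfig] at hu hv ⊢
    simp only [rot6inv] at hu hv ⊢
    omega

/-- The rows of `D(a,k,m)` are `0, …, 2a+1`. [cite: DavoliPiovanoStefanelli2017, §4.2 Step 1 p. 656–657] -/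
theorem image_snd_devConfig (a k m : ℕ) :
    (devConfig a k m).image Prod.snd = Finset.Icc (0 : ℤ) (2 * a + 1) := by
  ext y
  rw [Finset.mem_Icc]
  constructor
  · intro hy
    obtain ⟨p, hp, rfl⟩ := Finset.mem_image.1 hy
    rw [mem_devConfig] at hp
    omega
  · intro hy
    by_cases h1 : y ≤ a
    · refine Finset.mem_image.2 ⟨(2 * (a : ℤ) + 3 * k, y), ?_, rfl⟩
      rw [mem_devConfig]; dsimp only; omega
    · by_cases h2 : y ≤ 2 * a
      · refine Finset.mem_image.2 ⟨(3 * (a : ℤ) + 3 * k - y, y), ?_, rfl⟩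
        rw [mem_devConfig]; dsimp only; omega
      · refine Finset.mem_image.2 ⟨(0, y), ?_, rfl⟩
        rw [mem_devConfig]; dsimp only; omega

/-- The columns of `D(a,k,m)` are `0, …, 2a+3k`. [cite: DavoliPiovanoStefanelli2017, §4.2 Step 1 p. 656–657] -/
theorem image_fst_devConfig (a k m : ℕ) :
    (devConfig a k m).image Prod.fst = Finset.Icc (0 : ℤ) (2 * a + 3 * k) := by
  ext x
  rw [Finset.mem_Icc]
  constructor
  · intro hx
    obtain ⟨p, hp, rfl⟩ := Finset.mem_image.1 hx
    rw [mem_devConfig] at hp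
    omega
  · intro hx
    by_cases h1 : x ≤ a
    · refine Finset.mem_image.2 ⟨(x, (a : ℤ) - x), ?_, rfl⟩
      rw [mem_devConfig]; dsimp only; omega
    · refine Finset.mem_image.2 ⟨(x, 0), ?_, rfl⟩
      rw [mem_devConfig]; dsimp only; omega

/-- The diagonals `x + y = s` of `D(a,k,m)` are `s = a, …, 3a+3k` (when `m + 1 ≤ a + 3k`).
[cite: DavoliPiovanoStefanelli2017, §4.2 Step 1 p. 656–657] -/
theorem image_sum_devConfig {a k m : ℕ} (hm : m + 1 ≤ a + 3 * k) :
    ((devConfig a k m).image fun q => q.1 + q.2) = Finset.Icc (a : ℤ) (3 * a + 3 * k) := by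
  ext s
  rw [Finset.mem_Icc]
  constructor
  · intro hs
    obtain ⟨p, hp, rfl⟩ := Finset.mem_image.1 hs
    rw [mem_devConfig] at hp
    omega
  · intro hs
    by_cases h1 : s ≤ 2 * a + 3 * k
    · refine Finset.mem_image.2 ⟨(s, 0), ?_, by simp⟩
      rw [mem_devConfig]; dsimp only; omega
    · refine Finset.mem_image.2 ⟨(2 * (a : ℤ) + 3 * k, s - 2 * a - 3 * k), ?_, by dsimp only; omega⟩
      rw [mem_devConfig]; dsimp only; omega

/-- **The line count of `D(a,k,m)` is `6(a+k) + 4`** (`2a+2` rows, `2a+3k+1` columns, `2a+3k+1`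
diagonals). [cite: DavoliPiovanoStefanelli2017, §4.2 Step 1 p. 656–657] -/
theorem lineCount_devConfig {a k m : ℕ} (hm : m + 1 ≤ a + 3 * k) :
    lineCount (devConfig a k m) = 6 * (a + k) + 4 := by
  unfold lineCount
  rw [image_snd_image_rot6, image_snd_image_rot6_rot6, image_snd_devConfig, image_sum_devConfig hm,
    image_fst_devConfig, Int.card_Icc, Int.card_Icc, Int.card_Icc]
  omega

/-- **`#D(a,k,m) = (3a² + 3a + 1) + 3k(2a+1) + (m+1)`** (hexagon, swept strip, partial row).
[cite: DavoliPiovanoStefanelli2017, §4.2 Step 1 p. 656–657] -/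
theorem card_devConfig {a k m : ℕ} (hm : m ≤ 2 * a + 3 * k) :
    (devConfig a k m).card = 3 * a * (a + 1) + 1 + 3 * k * (2 * a + 1) + (m + 1) := by
  classical
  set A : Finset (ℤ × ℤ) := (hexagon a).image fun q => q + ((a : ℤ), (a : ℤ)) with hA
  set B : Finset (ℤ × ℤ) := ((Finset.Icc (1 : ℤ) (3 * k)) ×ˢ (Finset.Icc (0 : ℤ) (2 * a))).image
    fun jy : ℤ × ℤ => (min (2 * (a : ℤ)) (3 * a - jy.2) + jy.1, jy.2) with hB
  set C : Finset (ℤ × ℤ) := (Finset.Icc (0 : ℤ) m).image fun x : ℤ => (x, 2 * (a : ℤ) + 1) with hC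
  have mA : ∀ p : ℤ × ℤ, p ∈ A ↔ 0 ≤ p.1 ∧ p.1 ≤ 2 * a ∧ 0 ≤ p.2 ∧ p.2 ≤ 2 * a ∧
      (a : ℤ) ≤ p.1 + p.2 ∧ p.1 + p.2 ≤ 3 * a := by
    intro p
    rw [hA, Finset.mem_image]
    constructor
    · rintro ⟨q, hq, rfl⟩
      rw [mem_hexagon] at hq
      unfold Inside at hq
      simp only [Prod.fst_add, Prod.snd_add]
      omega
    · intro hp
      refine ⟨(p.1 - a, p.2 - a), ?_, Prod.ext (by simp) (by simp)⟩
      rw [mem_hexagon]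
      unfold Inside
      dsimp only
      omega
  have mB : ∀ p : ℤ × ℤ, p ∈ B ↔ 0 ≤ p.2 ∧ p.2 ≤ 2 * a ∧
      min (2 * (a : ℤ)) (3 * a - p.2) + 1 ≤ p.1 ∧ p.1 ≤ min (2 * (a : ℤ)) (3 * a - p.2) + 3 * k := by
    intro p
    rw [hB, Finset.mem_image]
    constructor
    · rintro ⟨⟨j, y⟩, hjy, rfl⟩
      rw [Finset.mem_product, Finset.mem_Icc, Finset.mem_Icc] at hjy
      dsimp only
      omega
    · intro hp
      refine ⟨(p.1 - min (2 * (a : ℤ)) (3 * a - p.2), p.2), ?_, Prod.ext (by simp) rfl⟩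
      rw [Finset.mem_product, Finset.mem_Icc, Finset.mem_Icc]
      dsimp only
      omega
  have mC : ∀ p : ℤ × ℤ, p ∈ C ↔ p.2 = 2 * a + 1 ∧ 0 ≤ p.1 ∧ p.1 ≤ m := by
    intro p
    rw [hC, Finset.mem_image]
    constructor
    · rintro ⟨x, hx, rfl⟩
      rw [Finset.mem_Icc] at hx
      dsimp only
      omega
    · intro hp
      exact ⟨p.1, by rw [Finset.mem_Icc]; omega, Prod.ext rfl hp.1.symm⟩
  have hS : devConfig a k m = A ∪ B ∪ C := by
    ext p
    rw [mem_devConfig, Finset.mem_union, Finset.mem_union, mA, mB, mC]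
    omega
  have dAB : Disjoint A B := Finset.disjoint_left.2 fun p hpA hpB => by
    rw [mA] at hpA; rw [mB] at hpB; omega
  have dABC : Disjoint (A ∪ B) C := Finset.disjoint_left.2 fun p hp hpC => by
    rw [Finset.mem_union, mA, mB] at hp; rw [mC] at hpC; omega
  have cA : A.card = 3 * a * (a + 1) + 1 := by
    rw [hA, Finset.card_image_of_injective _ (add_left_injective _), Schmidt2013.card_hexagon]
  have cB : B.card = 3 * k * (2 * a + 1) := by
    rw [hB, Finset.card_image_of_injective, Finset.card_product, Int.card_Icc, Int.card_Icc]
    · have h1 : ((3 * k : ℤ) + 1 - 1).toNat = 3 * k := by omega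
      have h2 : ((2 * a : ℤ) + 1 - 0).toNat = 2 * a + 1 := by omega
      rw [h1, h2]
    · rintro ⟨j, y⟩ ⟨j', y'⟩ h
      simp only [Prod.mk.injEq] at h
      obtain ⟨h1, h2⟩ := h
      subst h2
      exact Prod.ext (by dsimp only; omega) rfl
  have cC : C.card = m + 1 := by
    rw [hC, Finset.card_image_of_injective, Int.card_Icc]
    · omega
    · intro x x' h
      simpa using congrArg Prod.fst h
  rw [hS, Finset.card_union_of_disjoint dABC, Finset.card_union_of_disjoint dAB, cA, cB, cC]

/-- **No translate of `H_{a+1}` fits into `D(a,k,m)`** (it has only `2a + 2` rows): the maximal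
radius of `triPoint(D(a,k,m))` is at most `a`. [cite: DavoliPiovanoStefanelli2017, §4.2 Step 1 p. 656–657] -/
theorem maxHexRadius_devConfig_le {a k m : ℕ} (hne : (devConfig a k m).Nonempty) :
    maxHexRadius ((devConfig a k m).image triPoint) ≤ a := by
  obtain ⟨⟨c, hc⟩, -⟩ := maxHexRadius_image_triPoint_spec hne
  set r := maxHexRadius ((devConfig a k m).image triPoint) with hr
  rw [mem_erodeN] at hc
  have h1 := hc (0, (r : ℤ)) (by rw [mem_hexagon]; unfold Inside; dsimp only; omega)
  have h2 := hc (0, -(r : ℤ)) (by rw [mem_hexagon]; unfold Inside; dsimp only; omega)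
  rw [mem_devConfig] at h1 h2
  simp only [Prod.fst_add, Prod.snd_add] at h1 h2
  omega

/-! ## §2 Minimality: 3-convex label sets with `⌈√(12n−3)⌉` lines are minimizers -/

/-- **Converse of `lineCount_eq_ceil`**: a 3-convex label set with `L(S) = ⌈√(12n − 3)⌉` lines has
`b = 3n − L = [3n − √(12n−3)]` bonds, i.e. attains Harborth's bound: `triPoint(S)` is an EIP
minimizer. [cite: DavoliPiovanoStefanelli2017, (10)–(12) p. 630; §4.2 Step 1 ("P(M_n) = p_n") p. 657] -/
theorem isTriMinimizer_of_lineCount_eq {S : Finset (ℤ × ℤ)} (hconv : IsTriConvex S)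
    (hL : (lineCount S : ℤ) = ⌈Real.sqrt (12 * S.card - 3)⌉) :
    IsTriMinimizer (S.image triPoint) := by
  rw [isTriMinimizer_image_triPoint_iff]
  have h1 := bondCount_add_lineCount hconv
  have h3 := adjCount_eq_two_mul_bondCount S
  have h4 := harborthNumber_eq_sub_ceil S.card
  have h6 : ((bondCount S : ℕ) : ℤ) + lineCount S = 3 * S.card := by exact_mod_cast h1
  have h7 : (adjCount S : ℤ) = 2 * bondCount S := by exact_mod_cast h3
  rw [h4]
  linarith

/-- `⌈√(12 n_i − 3)⌉ = 6i + 4` for `n_i = 3i² + 3i + 2`, `i ≥ 1` (`12n_i − 3 = (6i+3)² + 12`).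
[cite: DavoliPiovanoStefanelli2017, §4.2 Step 2 p. 657] -/
theorem ceil_sqrt_eq {i : ℕ} (hi : 1 ≤ i) :
    ⌈Real.sqrt (12 * ((3 * i ^ 2 + 3 * i + 2 : ℕ) : ℝ) - 3)⌉ = 6 * i + 4 := by
  have hi' : (1 : ℝ) ≤ i := by exact_mod_cast hi
  rw [Int.ceil_eq_iff]
  push_cast
  constructor
  · rw [show (6 * (i : ℝ) + 4 - 1) = 6 * i + 3 by ring, Real.lt_sqrt (by positivity)]
    nlinarith
  · rw [Real.sqrt_le_left (by positivity)]
    nlinarith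

/-! ## §3 The sequence of maximal-deviation minimizers -/

/-- `k(i) := ⌊√⌊i/3⌋⌋`, the number of sweeping steps divided by three. [cite: DavoliPiovanoStefanelli2017, §4.2 Step 1 (86) p. 656] -/
def kOf (i : ℕ) : ℕ := Nat.sqrt (i / 3)

/-- `3 k(i)² ≤ i < 3 (k(i)+1)²`. [cite: DavoliPiovanoStefanelli2017, §4.2 Step 1 (86) p. 656] -/
theorem kOf_spec (i : ℕ) : 3 * (kOf i * kOf i) ≤ i ∧ i < 3 * ((kOf i + 1) * (kOf i + 1)) := by
  have h1 := Nat.sqrt_le (i / 3)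
  have h2 : i / 3 < (Nat.sqrt (i / 3) + 1) * (Nat.sqrt (i / 3) + 1) := Nat.lt_succ_sqrt (i / 3)
  unfold kOf
  constructor <;> omega

/-- `k(i) ≤ i`. [cite: DavoliPiovanoStefanelli2017, §4.2 Step 1 (86) p. 656] -/
theorem kOf_le (i : ℕ) : kOf i ≤ i := by
  have h1 := (kOf_spec i).1
  have h2 := Nat.le_mul_self (kOf i)
  omega

/-- The two side conditions on the parameters of `S_i`: `3k(i)² + 1 ≤ (i − k(i)) + 3k(i)` (for
`i ≥ 1`) and `3k(i)² ≤ 2(i − k(i)) + 3k(i)`. [cite: DavoliPiovanoStefanelli2017, §4.2 Step 1 (90) p. 657] -/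
theorem kOf_cond (i : ℕ) :
    (1 ≤ i → 3 * (kOf i * kOf i) + 1 ≤ (i - kOf i) + 3 * kOf i) ∧
      3 * (kOf i * kOf i) ≤ 2 * (i - kOf i) + 3 * kOf i := by
  have h1 := (kOf_spec i).1
  have h2 := kOf_le i
  refine ⟨fun hi => ?_, by omega⟩
  rcases Nat.eq_zero_or_pos (kOf i) with h0 | hpos
  · rw [h0]; omega
  · omega

/-- **The label sets `S_i := D(i − k(i), k(i), 3k(i)²)`** (`S_0 = {(0,0),(0,1)}`).
[cite: DavoliPiovanoStefanelli2017, §4.2 Step 1 p. 656–657] -/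
def sharpLabels (i : ℕ) : Finset (ℤ × ℤ) :=
  devConfig (i - kOf i) (kOf i) (3 * (kOf i * kOf i))

/-- **The minimizers `M_{n_i} := triPoint(S_i)`.** [cite: DavoliPiovanoStefanelli2017, Theorem 1.4 p. 634; §4.2 Step 1 p. 656–657] -/
def sharpConfig (i : ℕ) : Finset Plane :=
  (sharpLabels i).image triPoint

/-- `#S_i = n_i = 3i² + 3i + 2`. [cite: DavoliPiovanoStefanelli2017, §4.2 Step 1 (90) p. 657] -/
theorem card_sharpLabels (i : ℕ) : (sharpLabels i).card = 3 * i ^ 2 + 3 * i + 2 := by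
  have h1 := (kOf_spec i).1
  have h2 := kOf_le i
  have h3 := (kOf_cond i).2
  unfold sharpLabels
  rw [card_devConfig h3]
  obtain ⟨K, hK⟩ : ∃ K, kOf i = K := ⟨_, rfl⟩
  rw [hK] at h2 ⊢
  obtain ⟨a, rfl⟩ : ∃ a, i = a + K := ⟨i - K, by omega⟩
  rw [Nat.add_sub_cancel]
  ring

/-- `#M_{n_i} = n_i`. [cite: DavoliPiovanoStefanelli2017, §4.2 Step 1 (90) p. 657] -/
theorem card_sharpConfig (i : ℕ) : (sharpConfig i).card = 2 + 3 * i + 3 * i ^ 2 := by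
  unfold sharpConfig
  rw [Finset.card_image_of_injective _ triPoint_injective, card_sharpLabels]
  ring

/-- `S_0 = {(0,0), (0,1)}` has `5 = ⌈√21⌉` lines. [cite: DavoliPiovanoStefanelli2017, (12) p. 630] -/
theorem lineCount_sharpLabels_zero : lineCount (sharpLabels 0) = 5 := by
  have h0 : sharpLabels 0 = {((0 : ℤ), (0 : ℤ)), ((0 : ℤ), (1 : ℤ))} := by
    ext ⟨x, y⟩
    rw [sharpLabels, kOf, show Nat.sqrt (0 / 3) = 0 by decide, mem_devConfig, Finset.mem_insert,
      Finset.mem_singleton, Prod.mk.injEq, Prod.mk.injEq]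
    push_cast
    omega
  rw [h0]
  decide

/-- **`M_{n_i}` is an EIP minimizer** (3-convex with `⌈√(12 n_i − 3)⌉ = 6i + 4` lines).
[cite: DavoliPiovanoStefanelli2017, Theorem 1.4 p. 634; §4.2 Step 1 ("P(M_n) = p_n") p. 657] -/
theorem isTriMinimizer_sharpConfig (i : ℕ) : IsTriMinimizer (sharpConfig i) := by
  have h1 := (kOf_spec i).1
  have h2 := kOf_le i
  have h3 := kOf_cond i
  unfold sharpConfig
  refine isTriMinimizer_of_lineCount_eq (isTriConvex_devConfig (by omega)) ?_
  rw [card_sharpLabels]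
  rcases Nat.eq_zero_or_pos i with rfl | hi
  · rw [lineCount_sharpLabels_zero, eq_comm, Int.ceil_eq_iff]
    push_cast
    constructor
    · rw [show ((5 : ℝ) - 1) = 4 by norm_num, Real.lt_sqrt (by norm_num)]; norm_num
    · rw [Real.sqrt_le_left (by norm_num)]; norm_num
  · rw [ceil_sqrt_eq hi]
    unfold sharpLabels
    rw [lineCount_devConfig (h3.1 hi)]
    push_cast
    have : ((i - kOf i : ℕ) : ℤ) = i - kOf i := by push_cast [Nat.cast_sub h2]; ring
    rw [this]
    ring

/-- **The maximal hexagon of `M_{n_i}` has radius `≤ i − k(i)`.** [cite: DavoliPiovanoStefanelli2017, §4.2 Substep 1.2 (91)–(92) p. 657] -/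
theorem maxHexRadius_sharpConfig_le (i : ℕ) : maxHexRadius (sharpConfig i) ≤ i - kOf i := by
  unfold sharpConfig sharpLabels
  refine maxHexRadius_devConfig_le ?_
  rw [← Finset.card_pos]
  have := card_sharpLabels i
  unfold sharpLabels at this
  omega

/-- **The deviation of `M_{n_i}` from its maximal hexagon**: `n_i − #H_{r(M_{n_i})} ≥
6 i k(i) − 3k(i)² + 3k(i) + 1` (`= n_i − #H_{i − k(i)}`). [cite: DavoliPiovanoStefanelli2017, §4.2 Substep 1.2 (91)–(92) p. 657] -/
theorem deviation_sharpConfig_ge (i : ℕ) :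
    (6 * i * kOf i : ℝ) - 3 * (kOf i) ^ 2 + 3 * kOf i + 1 ≤
      ((2 + 3 * i + 3 * i ^ 2 : ℕ) : ℝ) - ((hexagon (maxHexRadius (sharpConfig i))).card : ℝ) := by
  have h2 := kOf_le i
  have hr := maxHexRadius_sharpConfig_le i
  have hc : (hexagon (maxHexRadius (sharpConfig i))).card ≤ (hexagon (i - kOf i)).card :=
    Finset.card_le_card (hexagon_mono hr)
  rw [Schmidt2013.card_hexagon (i - kOf i)] at hc
  have hc' : ((hexagon (maxHexRadius (sharpConfig i))).card : ℝ) ≤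
      3 * ((i : ℝ) - kOf i) * ((i : ℝ) - kOf i + 1) + 1 := by
    have : ((hexagon (maxHexRadius (sharpConfig i))).card : ℝ) ≤
        ((3 * (i - kOf i) * (i - kOf i + 1) + 1 : ℕ) : ℝ) := by exact_mod_cast hc
    rw [Nat.cast_add, Nat.cast_mul, Nat.cast_mul, Nat.cast_add, Nat.cast_sub h2] at this
    simpa using this
  push_cast
  nlinarith [hc']

/-! ## §4 The limit `(n_i − #H_{r(M_{n_i})}) / n_i^{3/4} → K_t` -/

/-- `x^{3/4} = √x · √(√x)` for `x ≥ 0`. [cite: DavoliPiovanoStefanelli2017, (19) p. 632] -/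
theorem rpow_three_quarters_eq {x : ℝ} (hx : 0 ≤ x) :
    x ^ (3 / 4 : ℝ) = Real.sqrt x * Real.sqrt (Real.sqrt x) := by
  rw [show (3 / 4 : ℝ) = 1 / 2 + 1 / 2 * (1 / 2) by norm_num, Real.rpow_add' hx (by norm_num),
    Real.rpow_mul hx, Real.sqrt_eq_rpow, Real.sqrt_eq_rpow]

/-- `K_t = 2/3^{1/4} = 2/√(√3)`. [cite: DavoliPiovanoStefanelli2017, (19) p. 632] -/
theorem sharpConstant_eq : sharpConstant = 2 / Real.sqrt (Real.sqrt 3) := by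
  unfold sharpConstant
  rw [show (1 / 4 : ℝ) = 1 / 2 * (1 / 2) by norm_num, Real.rpow_mul (by norm_num), Real.sqrt_eq_rpow,
    Real.sqrt_eq_rpow]

/-- **The deviation count of `S_i` in closed form, lower bound**:
`6 i k(i) − 3k(i)² + 3k(i) + 1 ≥ 2√3 · i√i − 7i` (from `3k² ≤ i < 3(k+1)²`).
[cite: DavoliPiovanoStefanelli2017, §4.2 Substep 1.2 (91)–(92) p. 657] -/
theorem six_mul_kOf_ge (i : ℕ) :
    2 * Real.sqrt 3 * (i : ℝ) * Real.sqrt i - 7 * i ≤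
      (6 * i * kOf i : ℝ) - 3 * (kOf i) ^ 2 + 3 * kOf i + 1 := by
  obtain ⟨h1, h2⟩ := kOf_spec i
  have hk0 : (0 : ℝ) ≤ kOf i := Nat.cast_nonneg _
  have ht0 : (0 : ℝ) ≤ i := Nat.cast_nonneg _
  have h1' : 3 * ((kOf i : ℝ) * kOf i) ≤ i := by exact_mod_cast h1
  have h2' : (i : ℝ) < 3 * (((kOf i : ℝ) + 1) * (kOf i + 1)) := by exact_mod_cast h2
  have h3 : Real.sqrt 3 * Real.sqrt 3 = 3 := Real.mul_self_sqrt (by norm_num)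
  have hk : Real.sqrt (i : ℝ) ≤ Real.sqrt 3 * (kOf i + 1) := by
    rw [Real.sqrt_le_left (by positivity), mul_pow, Real.sq_sqrt (by norm_num)]
    nlinarith
  have step : 2 * Real.sqrt 3 * (i : ℝ) * Real.sqrt i ≤ 6 * i * kOf i + 6 * i := by
    have := mul_le_mul_of_nonneg_left hk (by positivity : (0 : ℝ) ≤ 2 * Real.sqrt 3 * i)
    calc 2 * Real.sqrt 3 * (i : ℝ) * Real.sqrt i
        ≤ 2 * Real.sqrt 3 * i * (Real.sqrt 3 * (kOf i + 1)) := this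
      _ = 2 * (Real.sqrt 3 * Real.sqrt 3) * i * (kOf i + 1) := by ring
      _ = 6 * i * kOf i + 6 * i := by rw [h3]; ring
  nlinarith

/-- **Upper comparison sequence**: by the `N^{3/4}` law with explicit lower-order terms
(`card_sub_card_maxHexagon_le`), `(n_i − #H_{r(M_{n_i})})/n_i^{3/4} ≤ K_t + 6/√√n_i + 5/(√n_i √√n_i)`.
[cite: DavoliPiovanoStefanelli2017, (15) p. 632; (72)–(75) p. 653] -/
theorem ratio_sharpConfig_le (i : ℕ) :
    (((2 + 3 * i + 3 * i ^ 2 : ℕ) : ℝ) - ((hexagon (maxHexRadius (sharpConfig i))).card : ℝ)) /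
        ((2 + 3 * i + 3 * i ^ 2 : ℕ) : ℝ) ^ (3 / 4 : ℝ) ≤
      sharpConstant + 6 / Real.sqrt (Real.sqrt ((2 + 3 * i + 3 * i ^ 2 : ℕ) : ℝ)) +
        5 / (Real.sqrt ((2 + 3 * i + 3 * i ^ 2 : ℕ) : ℝ) *
          Real.sqrt (Real.sqrt ((2 + 3 * i + 3 * i ^ 2 : ℕ) : ℝ))) := by
  have hn : (0 : ℝ) < ((2 + 3 * i + 3 * i ^ 2 : ℕ) : ℝ) := by positivity
  have hM : (sharpConfig i).Nonempty := Finset.card_pos.1 (by rw [card_sharpConfig]; positivity)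
  have h := card_sub_card_maxHexagon_le hM (isTriMinimizer_sharpConfig i)
  rw [card_sharpConfig] at h
  have hD := rpow_three_quarters_eq hn.le
  rw [hD] at h ⊢
  have hs := Real.sqrt_pos.2 hn
  have hss := Real.sqrt_pos.2 hs
  rw [div_le_iff₀ (mul_pos hs hss)]
  have e : (sharpConstant + 6 / Real.sqrt (Real.sqrt ((2 + 3 * i + 3 * i ^ 2 : ℕ) : ℝ)) +
        5 / (Real.sqrt ((2 + 3 * i + 3 * i ^ 2 : ℕ) : ℝ) *
          Real.sqrt (Real.sqrt ((2 + 3 * i + 3 * i ^ 2 : ℕ) : ℝ)))) *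
        (Real.sqrt ((2 + 3 * i + 3 * i ^ 2 : ℕ) : ℝ) *
          Real.sqrt (Real.sqrt ((2 + 3 * i + 3 * i ^ 2 : ℕ) : ℝ))) =
      sharpConstant * (Real.sqrt ((2 + 3 * i + 3 * i ^ 2 : ℕ) : ℝ) *
          Real.sqrt (Real.sqrt ((2 + 3 * i + 3 * i ^ 2 : ℕ) : ℝ))) +
        6 * Real.sqrt ((2 + 3 * i + 3 * i ^ 2 : ℕ) : ℝ) + 5 := by
    field_simp
  rw [e]
  exact h

/-- **Lower comparison sequence**: since `r(M_{n_i}) ≤ i − k(i)`,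
`(n_i − #H_{r(M_{n_i})})/n_i^{3/4} ≥ (2√3 · i√i − 7i)/n_i^{3/4} =
(2√3 − 7/√i)/(√q_i · √√q_i)` with `q_i := n_i/i²`. [cite: DavoliPiovanoStefanelli2017, §4.2 Substep 1.2 (91)–(92) p. 657] -/
theorem le_ratio_sharpConfig {i : ℕ} (hi : 1 ≤ i) :
    (2 * Real.sqrt 3 - 7 / Real.sqrt i) /
        (Real.sqrt (((2 + 3 * i + 3 * i ^ 2 : ℕ) : ℝ) / (i : ℝ) ^ 2) *
          Real.sqrt (Real.sqrt (((2 + 3 * i + 3 * i ^ 2 : ℕ) : ℝ) / (i : ℝ) ^ 2))) ≤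
      (((2 + 3 * i + 3 * i ^ 2 : ℕ) : ℝ) - ((hexagon (maxHexRadius (sharpConfig i))).card : ℝ)) /
        ((2 + 3 * i + 3 * i ^ 2 : ℕ) : ℝ) ^ (3 / 4 : ℝ) := by
  have ht : (0 : ℝ) < i := by exact_mod_cast hi
  have hn : (0 : ℝ) < ((2 + 3 * i + 3 * i ^ 2 : ℕ) : ℝ) := by positivity
  have hdev := deviation_sharpConfig_ge i
  have hN := six_mul_kOf_ge i
  rw [rpow_three_quarters_eq hn.le]
  have hs := Real.sqrt_pos.2 ht
  have hsn := Real.sqrt_pos.2 hn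
  have hssn := Real.sqrt_pos.2 hsn
  have e1 : Real.sqrt (((2 + 3 * i + 3 * i ^ 2 : ℕ) : ℝ) / (i : ℝ) ^ 2) =
      Real.sqrt ((2 + 3 * i + 3 * i ^ 2 : ℕ) : ℝ) / i := by
    rw [Real.sqrt_div' _ (by positivity), Real.sqrt_sq ht.le]
  have e2 : Real.sqrt (Real.sqrt ((2 + 3 * i + 3 * i ^ 2 : ℕ) : ℝ) / i) =
      Real.sqrt (Real.sqrt ((2 + 3 * i + 3 * i ^ 2 : ℕ) : ℝ)) / Real.sqrt i := by
    rw [Real.sqrt_div' _ ht.le]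
  rw [e1, e2]
  have key : (2 * Real.sqrt 3 - 7 / Real.sqrt i) /
        (Real.sqrt ((2 + 3 * i + 3 * i ^ 2 : ℕ) : ℝ) / i *
          (Real.sqrt (Real.sqrt ((2 + 3 * i + 3 * i ^ 2 : ℕ) : ℝ)) / Real.sqrt i)) =
      (2 * Real.sqrt 3 * (i : ℝ) * Real.sqrt i - 7 * i) /
        (Real.sqrt ((2 + 3 * i + 3 * i ^ 2 : ℕ) : ℝ) *
          Real.sqrt (Real.sqrt ((2 + 3 * i + 3 * i ^ 2 : ℕ) : ℝ))) := by
    obtain ⟨s, hs_def, hs_sq⟩ : ∃ s : ℝ, Real.sqrt i = s ∧ (i : ℝ) = s * s :=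
      ⟨Real.sqrt i, rfl, (Real.mul_self_sqrt ht.le).symm⟩
    have hs0 : 0 < s := hs_def ▸ hs
    rw [hs_def, hs_sq]
    field_simp
  rw [key]
  exact div_le_div_of_nonneg_right (hN.trans hdev) (by positivity)

/-- **Theorem 1.4, the limit**: `(n_i − #H_{r(M_{n_i})}) / n_i^{3/4} → K_t = 2/3^{1/4}` along the
minimizers `M_{n_i} = triPoint(S_i)`, `n_i = 2 + 3i + 3i²` (squeezed between the two comparison
sequences, both tending to `K_t`). [cite: DavoliPiovanoStefanelli2017, Theorem 1.4 p. 634; §4.2 Steps 1–2 (85), (91)–(93) p. 656–658] -/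
theorem tendsto_ratio_sharpConfig :
    Tendsto (fun i : ℕ =>
        (((2 + 3 * i + 3 * i ^ 2 : ℕ) : ℝ) - ((hexagon (maxHexRadius (sharpConfig i))).card : ℝ)) /
          ((2 + 3 * i + 3 * i ^ 2 : ℕ) : ℝ) ^ (3 / 4 : ℝ))
      atTop (𝓝 sharpConstant) := by
  -- `n_i → ∞`, `√n_i → ∞`, `√√n_i → ∞`, `√i → ∞`
  have hE : Tendsto (fun i : ℕ => ((2 + 3 * i + 3 * i ^ 2 : ℕ) : ℝ)) atTop atTop := by
    refine tendsto_atTop_mono (fun i => ?_) tendsto_natCast_atTop_atTop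
    push_cast
    nlinarith [sq_nonneg (i : ℝ)]
  have hsE := Real.tendsto_sqrt_atTop.comp hE
  have hssE := Real.tendsto_sqrt_atTop.comp hsE
  have hsi : Tendsto (fun i : ℕ => Real.sqrt (i : ℝ)) atTop atTop :=
    Real.tendsto_sqrt_atTop.comp tendsto_natCast_atTop_atTop
  -- `q_i := n_i / i² → 3`
  have hq : Tendsto (fun i : ℕ => ((2 + 3 * i + 3 * i ^ 2 : ℕ) : ℝ) / (i : ℝ) ^ 2) atTop (𝓝 3) := by
    have h0 : Tendsto (fun n : ℕ => 1 / (n : ℝ)) atTop (𝓝 0) := tendsto_one_div_atTop_nhds_zero_nat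
    have h1 : Tendsto (fun i : ℕ => (3 : ℝ) + 3 * (1 / (i : ℝ)) + 2 * (1 / (i : ℝ)) ^ 2) atTop
        (𝓝 (3 + 3 * 0 + 2 * 0 ^ 2)) :=
      (tendsto_const_nhds.add (h0.const_mul 3)).add ((h0.pow 2).const_mul 2)
    rw [show (3 : ℝ) + 3 * 0 + 2 * 0 ^ 2 = 3 by norm_num] at h1
    refine h1.congr' ?_
    filter_upwards [Filter.eventually_ge_atTop 1] with i hi
    have hi' : (0 : ℝ) < i := by exact_mod_cast hi
    push_cast
    field_simp
    ring
  have hsq := (Real.continuous_sqrt.tendsto (3 : ℝ)).comp hq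
  have hssq := (Real.continuous_sqrt.tendsto (Real.sqrt 3)).comp hsq
  -- the upper comparison sequence tends to `K_t`
  have hu : Tendsto (fun i : ℕ => sharpConstant +
      6 / Real.sqrt (Real.sqrt ((2 + 3 * i + 3 * i ^ 2 : ℕ) : ℝ)) +
        5 / (Real.sqrt ((2 + 3 * i + 3 * i ^ 2 : ℕ) : ℝ) *
          Real.sqrt (Real.sqrt ((2 + 3 * i + 3 * i ^ 2 : ℕ) : ℝ)))) atTop (𝓝 sharpConstant) := by
    have h1 := (tendsto_const_nhds (x := (6 : ℝ))).div_atTop hssE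
    have h2 := (tendsto_const_nhds (x := (5 : ℝ))).div_atTop (hsE.atTop_mul_atTop₀ hssE)
    have := ((tendsto_const_nhds (x := sharpConstant)).add h1).add h2
    simpa using this
  -- the lower comparison sequence tends to `K_t`
  have hg : Tendsto (fun i : ℕ => (2 * Real.sqrt 3 - 7 / Real.sqrt i) /
      (Real.sqrt (((2 + 3 * i + 3 * i ^ 2 : ℕ) : ℝ) / (i : ℝ) ^ 2) *
        Real.sqrt (Real.sqrt (((2 + 3 * i + 3 * i ^ 2 : ℕ) : ℝ) / (i : ℝ) ^ 2)))) atTop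
      (𝓝 sharpConstant) := by
    have h1 := (tendsto_const_nhds (x := 2 * Real.sqrt 3)).sub
      ((tendsto_const_nhds (x := (7 : ℝ))).div_atTop hsi)
    have h2 := hsq.mul hssq
    have h3 : Real.sqrt 3 * Real.sqrt (Real.sqrt 3) ≠ 0 := by positivity
    have h4 := h1.div h2 h3
    have hK : (2 * Real.sqrt 3 - 0) / (Real.sqrt 3 * Real.sqrt (Real.sqrt 3)) = sharpConstant := by
      rw [sharpConstant_eq, sub_zero, div_eq_div_iff h3 (by positivity)]
      ring
    rw [hK] at h4
    exact h4
  refine tendsto_of_tendsto_of_tendsto_of_le_of_le' hg hu ?_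
    (Filter.Eventually.of_forall ratio_sharpConfig_le)
  filter_upwards [Filter.eventually_ge_atTop 1] with i hi using le_ratio_sharpConfig hi

/-- **Davoli–Piovano–Stefanelli 2017, Theorem 1.4 (sharpness of (15)) PROVED**: the named fact
`DavoliPiovanoStefanelli2017_sharpness` holds, witnessed by `M_{n_i} := sharpConfig i`.
[cite: DavoliPiovanoStefanelli2017, Theorem 1.4 p. 634; §4.2 p. 656–658] -/
theorem DavoliPiovanoStefanelli2017_sharpness_holds : DavoliPiovanoStefanelli2017_sharpness :=
  ⟨sharpConfig, fun i => ⟨isTriMinimizer_sharpConfig i, card_sharpConfig i⟩,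
    tendsto_ratio_sharpConfig⟩

end Literature.MathematicalPhysics.StatisticalMechanics.DavoliPiovanoStefanelli2017
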